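import Literature.AlgebraicGeometry.Motives.HodgeStructurePolarizationAutGroup
import Literature.AlgebraicGeometry.Motives.HodgeStructureCentralizerDirectSum
import Literature.AlgebraicGeometry.Motives.HodgeStructureProdPolarization
import HarnessLib

/-!
# The automorphism groups of an EXTERNAL direct sum `H₁ ⊕ H₂`: the block-diagonal embedding `Aut(H₁) × Aut(H₂) ↪ Aut(H₁ ⊕ H₂)`, onto iff
# `Hom(H₁, H₂) = 0 = Hom(H₂, H₁)` (Milne 1999 §1: «`C(A) ⊂ C(A₁) × ⋯ × C(A_s)`, with equality holding if and only if `Hom(Aᵢ, Aⱼ) = 0`», read on the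
# unit groups `E_φ^× = Aut`), and the polarized twins for `Q₁ ⊕ Q₂`

[topic AlgebraicGeometry/Motives]

Layer `Literature/AlgebraicGeometry/Motives`, lane `lit-hodgefound` (Track 2 foundations library; seat `lit-hodgefound-p02`, gen 45, row g45-#6; the g44 FINAL pointer (δ)).
FOUR DEFINITIONS WITH BODIES (the block-diagonal homomorphisms and, when the mixed Hom spaces vanish, the `MulEquiv`s) and THEOREMS; no named fact (D-0026
net debt `0`), no instance, no notation. The INTERNAL version (a Hodge structure split along complementary sub-Hodge structures `S ⊕ T` with
`Hom(S, T) = Hom(T, S) = 0`: `autGroupProdMulEquiv : Aut(H) ≃* Aut(S) × Aut(T)`) is g44-#4 `Motives/HodgeStructureHodgeVectorBlockAutGroups` and the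
family version g44-#3 `Motives/HodgeStructurePolarizationAutGroupBlocks`; this file treats the EXTERNAL direct sum `H₁.prod H₂` on `V₁ × V₂`
(`Motives/HodgeStructure`, Deligne Hodge II 2.1) with the block calculus of p34's `Motives/HodgeStructureCentralizerDirectSum` (the four blocks of
`E_φ(H₁ ⊕ H₂)`: `inl ∘ a ∘ fst`, …, off-diagonal blocks are morphisms), the product polarization `Q₁.prod Q₂` (`Motives/HodgeStructureProdPolarization`),
and g44-#1's groups `autGroup`, `Polarization.isometryGroup`, `Polarization.autGroup`.

## Sources, verbatim

* J. S. Milne, *Lefschetz classes on abelian varieties*, Duke Math. J. 96 (1999) [Milne1999LefschetzClasses], §1 p. 643 (held `paper:doi-10-1215-s0012-7094-99-09620-5`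
  p0005 L12–L27): «Let `A = A₁ × ⋯ × A_s`. Then `C(A) ⊂ C(A₁) × ⋯ × C(A_s)`, with equality holding if and only if `Hom(Aᵢ, Aⱼ) = 0` for all `i, j`,
  `i ≠ j`.» (for `C(A)` the centraliser of `End⁰(A)`; the same block argument applies verbatim to `End⁰` itself and to its unit group).
* B. Moonen, *Notes on Mumford–Tate groups* (1999) [Moonen1999MTNotes], (1.8): «`MT(V^{⊕n})` (`n ≥ 1`) is isomorphic to `MT(V)` acting diagonally on `V^{⊕n}`.»;
  B. Moonen, *An introduction to Mumford–Tate groups* (2004) [Moonen2004MT], §4 Lemma 4.6 (block-diagonality on `V₁ ⊕ V₂`).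
* P. Deligne, *Théorie de Hodge II* [DeligneHodgeII1971], 2.1 (direct sums and morphisms of Hodge structures: `HS` is an abelian category).

## Dictionary and mechanism

`(g₁, g₂) ↦ g₁ ⊕ g₂ = LinearEquiv.prodCongr g₁ g₂`, `↑(g₁ ⊕ g₂) = (↑g₁).prodMap ↑g₂` (Mathlib `LinearEquiv.coe_prodCongr`). ENDOMORPHISMS: `a ⊕ b ∈ E_φ(H₁ ⊕ H₂) ⟺
a ∈ E_φ(H₁) ∧ b ∈ E_φ(H₂)` (`prodMap_mem_endAlg_prod_iff`: the blocks `fst ∘ (a ⊕ b) ∘ inl = a`, and `a ⊕ b = inl a fst + inr b snd`). AUTOMORPHISMS: hence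
`g₁ ⊕ g₂ ∈ Aut(H₁ ⊕ H₂) ⟺ gᵢ ∈ Aut(Hᵢ)` and the injective homomorphism `autGroupProdCongrHom`. ONTO ⟸ `Hom = 0`: the off-diagonal blocks of `↑g ∈ E_φ(H₁ ⊕ H₂)`
are morphisms `H₁ → H₂`, `H₂ → H₁` (p34), hence `0`, so `↑g` and `↑g⁻¹` are block diagonal with mutually inverse blocks (`eq_prodMap_of_mem_endAlg_prod`,
`autGroupProdCongrHom_surjective`). ONTO ⟹ `Hom = 0`: for a morphism `f : H₁ → H₂` the UNIPOTENT `u_f = 1 + inr ∘ f ∘ fst ∈ Aut(H₁ ⊕ H₂)` (`(inr f fst)² = 0`)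
maps `(v, 0) ↦ (v, f v)`, so it is block diagonal only if `f = 0` (`hom_eq_zero_of_autGroupProdCongrHom_surjective`). POLARIZED: `(Q₁ ⊕ Q₂)((v, w), (v′, w′)) =
Q₁(v, v′) + Q₂(w, w′)`, so `g₁ ⊕ g₂` is an isometry iff both `gᵢ` are (test on `(v, 0)`, `(0, w)`).

## What is defined / proved (`V₁ V₂` finite-dimensional, `H₁ : HodgeStructure V₁ n`, `H₂ : HodgeStructure V₂ n`, `Q₁ Q₂` polarizations)

* §1 `prodMap_mem_endAlg_prod`, **`prodMap_mem_endAlg_prod_iff`**, `apply_eq_blocks_of_mem_endAlg_prod`,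
  **`eq_prodMap_of_mem_endAlg_prod`** (`Hom = 0`: every Hodge endomorphism of `H₁ ⊕ H₂` is block diagonal).
* §2 **`prodCongr_mem_autGroup_prod_iff`**, DEF **`autGroupProdCongrHom : H₁.autGroup × H₂.autGroup →* (H₁.prod H₂).autGroup`** (+ `coe_…_apply`),
  `autGroupProdCongrHom_injective`, **`autGroupProdCongrHom_surjective`** (`Hom = 0`), `one_add_inr_hom_fst_mem_autGroup` (the unipotent `u_f`),
  **`hom_eq_zero_of_autGroupProdCongrHom_surjective`**, **`autGroupProdCongrHom_surjective_iff`** (Milne's «equality iff `Hom(Aᵢ, Aⱼ) = 0`» on `Aut`),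
  DEF **`autGroupProdCongrMulEquiv`** (`Aut(H₁) × Aut(H₂) ≃* Aut(H₁ ⊕ H₂)` when `Hom = 0`; + `coe_…_apply`).
* §3 **`prodCongr_mem_isometryGroup_prod_iff`**, **`prodCongr_mem_polarizationAutGroup_prod_iff`**, DEF `Polarization.autGroupProdCongrHom` (+ apply, injective),
  **`Polarization.autGroupProdCongrHom_surjective`** (`Hom = 0`), DEF **`Polarization.autGroupProdCongrMulEquiv`** (`Aut(H₁, Q₁) × Aut(H₂, Q₂) ≃* Aut(H₁ ⊕ H₂, Q₁ ⊕ Q₂)`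
  when `Hom = 0`; + apply).

## References

* [Milne1999LefschetzClasses] J. S. Milne, *Lefschetz classes on abelian varieties*, Duke Math. J. 96 (1999): §1 p. 643.
* [Moonen1999MTNotes] B. Moonen, *Notes on Mumford–Tate groups* (1999): (1.8).
* [Moonen2004MT] B. Moonen, *An introduction to Mumford–Tate groups* (2004): §4 Lemma 4.6.
* [DeligneHodgeII1971] P. Deligne, *Théorie de Hodge II*, Publ. Math. IHÉS 40 (1971): 2.1.
-/

noncomputable section

open Module
open scoped TensorProduct

namespace Literature.AlgebraicGeometry.Motives

namespace HodgeStructure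

universe u

variable {V₁ : Type u} [AddCommGroup V₁] [Module ℚ V₁] {V₂ : Type u} [AddCommGroup V₂] [Module ℚ V₂] {n : ℤ}
  {H₁ : HodgeStructure V₁ n} {H₂ : HodgeStructure V₂ n}

/-! ## §1 `E_φ(H₁ ⊕ H₂) ⊇ E_φ(H₁) × E_φ(H₂)` block-diagonally, with equality when `Hom(H₁, H₂) = Hom(H₂, H₁) = 0` -/

/-- `a ⊕ b = inl ∘ a ∘ fst + inr ∘ b ∘ snd` (plumbing). [folklore] -/
private theorem prodMap_eq_inl_add_inr (a : Module.End ℚ V₁) (b : Module.End ℚ V₂) :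
    a.prodMap b = LinearMap.inl ℚ V₁ V₂ ∘ₗ a ∘ₗ LinearMap.fst ℚ V₁ V₂ + LinearMap.inr ℚ V₁ V₂ ∘ₗ b ∘ₗ LinearMap.snd ℚ V₁ V₂ := by
  ext <;> simp

/-- `fst ∘ (a ⊕ b) ∘ inl = a` (plumbing). [folklore] -/
private theorem fst_prodMap_inl (a : Module.End ℚ V₁) (b : Module.End ℚ V₂) :
    LinearMap.fst ℚ V₁ V₂ ∘ₗ a.prodMap b ∘ₗ LinearMap.inl ℚ V₁ V₂ = a := by
  ext; simp

/-- `snd ∘ (a ⊕ b) ∘ inr = b` (plumbing). [folklore] -/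
private theorem snd_prodMap_inr (a : Module.End ℚ V₁) (b : Module.End ℚ V₂) :
    LinearMap.snd ℚ V₁ V₂ ∘ₗ a.prodMap b ∘ₗ LinearMap.inr ℚ V₁ V₂ = b := by
  ext; simp

/-- **`a ⊕ b ∈ E_φ(H₁ ⊕ H₂)` for `a ∈ E_φ(H₁)`, `b ∈ E_φ(H₂)`** (direct sum of morphisms). [cite: DeligneHodgeII1971, 2.1] [cite: Milne1999LefschetzClasses, §1 p. 643] -/
theorem prodMap_mem_endAlg_prod {a : Module.End ℚ V₁} {b : Module.End ℚ V₂} (ha : a ∈ H₁.endAlg) (hb : b ∈ H₂.endAlg) :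
    a.prodMap b ∈ (H₁.prod H₂).endAlg := by
  rw [prodMap_eq_inl_add_inr]
  exact (H₁.prod H₂).endAlg.add_mem (inl_comp_comp_fst_mem_endAlg_prod H₁ H₂ ha) (inr_comp_comp_snd_mem_endAlg_prod H₁ H₂ hb)

/-- **`a ⊕ b ∈ E_φ(H₁ ⊕ H₂) ⟺ a ∈ E_φ(H₁) ∧ b ∈ E_φ(H₂)`** (the diagonal blocks of a Hodge endomorphism are Hodge endomorphisms).
[cite: Milne1999LefschetzClasses, §1 p. 643] [cite: DeligneHodgeII1971, 2.1] -/
theorem prodMap_mem_endAlg_prod_iff (a : Module.End ℚ V₁) (b : Module.End ℚ V₂) :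
    a.prodMap b ∈ (H₁.prod H₂).endAlg ↔ a ∈ H₁.endAlg ∧ b ∈ H₂.endAlg := by
  refine ⟨fun h ↦ ⟨?_, ?_⟩, fun h ↦ prodMap_mem_endAlg_prod h.1 h.2⟩
  · have h1 := fst_comp_comp_inl_mem_endAlg H₁ H₂ h
    rwa [fst_prodMap_inl] at h1
  · have h2 := snd_comp_comp_inr_mem_endAlg H₁ H₂ h
    rwa [snd_prodMap_inr] at h2

omit [AddCommGroup V₁] [Module ℚ V₁] [AddCommGroup V₂] [Module ℚ V₂] in
/-- `x = inl x.1 + inr x.2` (plumbing). [folklore] -/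
private theorem eq_inl_add_inr₄₆ [AddCommGroup V₁] [Module ℚ V₁] [AddCommGroup V₂] [Module ℚ V₂] (x : V₁ × V₂) :
    x = LinearMap.inl ℚ V₁ V₂ x.1 + LinearMap.inr ℚ V₁ V₂ x.2 := by
  simp

/-- **Every Hodge endomorphism of `H₁ ⊕ H₂` is BLOCK DIAGONAL when `Hom(H₁, H₂) = Hom(H₂, H₁) = 0`**, on vectors: `a (v, w) = (a₁₁ v, a₂₂ w)` (the off-diagonal
blocks are morphisms between the summands, p34's `exists_hom_toLinearMap_eq_snd_comp_comp_inl` ∕ `…_fst_comp_comp_inr`). [cite: Milne1999LefschetzClasses, §1 p. 643]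
[cite: Moonen2004MT, §4 Lemma 4.6] -/
theorem apply_eq_blocks_of_mem_endAlg_prod (hST : ∀ f : Hom H₁ H₂, f = 0) (hTS : ∀ g : Hom H₂ H₁, g = 0) {a : Module.End ℚ (V₁ × V₂)}
    (ha : a ∈ (H₁.prod H₂).endAlg) (x : V₁ × V₂) :
    a x = ((LinearMap.fst ℚ V₁ V₂ ∘ₗ a ∘ₗ LinearMap.inl ℚ V₁ V₂) x.1, (LinearMap.snd ℚ V₁ V₂ ∘ₗ a ∘ₗ LinearMap.inr ℚ V₁ V₂) x.2) := by
  obtain ⟨f, hf⟩ := exists_hom_toLinearMap_eq_snd_comp_comp_inl H₁ H₂ ha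
  obtain ⟨g, hg⟩ := exists_hom_toLinearMap_eq_fst_comp_comp_inr H₁ H₂ ha
  have h21 : LinearMap.snd ℚ V₁ V₂ ∘ₗ a ∘ₗ LinearMap.inl ℚ V₁ V₂ = 0 := by rw [← hf, hST f]; rfl
  have h12 : LinearMap.fst ℚ V₁ V₂ ∘ₗ a ∘ₗ LinearMap.inr ℚ V₁ V₂ = 0 := by rw [← hg, hTS g]; rfl
  have hx : a x = a (LinearMap.inl ℚ V₁ V₂ x.1) + a (LinearMap.inr ℚ V₁ V₂ x.2) := by
    conv_lhs => rw [eq_inl_add_inr₄₆ x]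
    rw [map_add]
  refine Prod.ext ?_ ?_
  · have h := LinearMap.congr_fun h12 x.2
    simp only [LinearMap.coe_comp, Function.comp_apply, LinearMap.zero_apply, LinearMap.fst_apply] at h
    simp only [hx, Prod.fst_add, h, add_zero, LinearMap.coe_comp, Function.comp_apply, LinearMap.fst_apply]
  · have h := LinearMap.congr_fun h21 x.1
    simp only [LinearMap.coe_comp, Function.comp_apply, LinearMap.zero_apply, LinearMap.snd_apply] at h
    simp only [hx, Prod.snd_add, h, zero_add, LinearMap.coe_comp, Function.comp_apply, LinearMap.snd_apply]

/-- **`Hom = 0` ⟹ `a = a₁₁ ⊕ a₂₂` for every `a ∈ E_φ(H₁ ⊕ H₂)`** («with equality holding if and only if `Hom(Aᵢ, Aⱼ) = 0`», the inclusion `E_φ(H₁ ⊕ H₂) ⊆ E_φ(H₁) × E_φ(H₂)`).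
[cite: Milne1999LefschetzClasses, §1 p. 643] [cite: Moonen2004MT, §4 Lemma 4.6] -/
theorem eq_prodMap_of_mem_endAlg_prod (hST : ∀ f : Hom H₁ H₂, f = 0) (hTS : ∀ g : Hom H₂ H₁, g = 0) {a : Module.End ℚ (V₁ × V₂)}
    (ha : a ∈ (H₁.prod H₂).endAlg) :
    a = (LinearMap.fst ℚ V₁ V₂ ∘ₗ a ∘ₗ LinearMap.inl ℚ V₁ V₂).prodMap (LinearMap.snd ℚ V₁ V₂ ∘ₗ a ∘ₗ LinearMap.inr ℚ V₁ V₂) :=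
  LinearMap.ext fun x ↦ by rw [apply_eq_blocks_of_mem_endAlg_prod hST hTS ha x, LinearMap.prodMap_apply]

/-! ## §2 `Aut(H₁) × Aut(H₂) ↪ Aut(H₁ ⊕ H₂)`, onto iff `Hom(H₁, H₂) = Hom(H₂, H₁) = 0` -/

section Aut

variable [Module.Finite ℚ V₁] [Module.Finite ℚ V₂]

/-- **`g₁ ⊕ g₂ ∈ Aut(H₁ ⊕ H₂) ⟺ g₁ ∈ Aut(H₁) ∧ g₂ ∈ Aut(H₂)`.** [cite: Milne1999LefschetzClasses, §1 p. 643] [cite: Moonen1999MTNotes, (1.8)] -/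
theorem prodCongr_mem_autGroup_prod_iff (g₁ : V₁ ≃ₗ[ℚ] V₁) (g₂ : V₂ ≃ₗ[ℚ] V₂) :
    g₁.prodCongr g₂ ∈ (H₁.prod H₂).autGroup ↔ g₁ ∈ H₁.autGroup ∧ g₂ ∈ H₂.autGroup := by
  rw [mem_autGroup_iff, LinearEquiv.coe_prodCongr, prodMap_mem_endAlg_prod_iff, ← mem_autGroup_iff, ← mem_autGroup_iff]

variable (H₁ H₂) in
/-- **The block-diagonal homomorphism `Aut(H₁) × Aut(H₂) →* Aut(H₁ ⊕ H₂)`, `(g₁, g₂) ↦ g₁ ⊕ g₂`.** [cite: Milne1999LefschetzClasses, §1 p. 643] -/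
def autGroupProdCongrHom : H₁.autGroup × H₂.autGroup →* (H₁.prod H₂).autGroup where
  toFun g := ⟨g.1.1.prodCongr g.2.1, (prodCongr_mem_autGroup_prod_iff g.1.1 g.2.1).2 ⟨g.1.2, g.2.2⟩⟩
  map_one' := Subtype.ext (LinearEquiv.ext fun _ ↦ rfl)
  map_mul' _ _ := Subtype.ext (LinearEquiv.ext fun _ ↦ rfl)

/-- `autGroupProdCongrHom (g₁, g₂) = g₁ ⊕ g₂`. [cite: Milne1999LefschetzClasses, §1 p. 643] -/
@[simp]
theorem coe_autGroupProdCongrHom_apply (g : H₁.autGroup × H₂.autGroup) :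
    ((autGroupProdCongrHom H₁ H₂ g : (H₁.prod H₂).autGroup) : (V₁ × V₂) ≃ₗ[ℚ] (V₁ × V₂)) = g.1.1.prodCongr g.2.1 :=
  rfl

/-- **`Aut(H₁) × Aut(H₂) →* Aut(H₁ ⊕ H₂)` is injective.** [cite: Milne1999LefschetzClasses, §1 p. 643] -/
theorem autGroupProdCongrHom_injective : Function.Injective (autGroupProdCongrHom H₁ H₂) := by
  intro x y h
  have h' : x.1.1.prodCongr x.2.1 = y.1.1.prodCongr y.2.1 := congrArg Subtype.val h
  refine Prod.ext (Subtype.ext (LinearEquiv.ext fun v ↦ ?_)) (Subtype.ext (LinearEquiv.ext fun w ↦ ?_))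
  · have h1 := LinearEquiv.congr_fun h' (v, 0)
    rw [LinearEquiv.prodCongr_apply, LinearEquiv.prodCongr_apply] at h1
    exact (Prod.ext_iff.1 h1).1
  · have h1 := LinearEquiv.congr_fun h' (0, w)
    rw [LinearEquiv.prodCongr_apply, LinearEquiv.prodCongr_apply] at h1
    exact (Prod.ext_iff.1 h1).2

omit [Module.Finite ℚ V₁] [Module.Finite ℚ V₂] in
/-- `↑g * ↑g⁻¹ = 1` (plumbing). [folklore] -/
private theorem coe_mul_coe_inv₄₆ (g : (V₁ × V₂) ≃ₗ[ℚ] (V₁ × V₂)) :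
    (g : Module.End ℚ (V₁ × V₂)) * ((g⁻¹ : (V₁ × V₂) ≃ₗ[ℚ] (V₁ × V₂)) : Module.End ℚ (V₁ × V₂)) = 1 := by
  rw [← LinearEquiv.coe_toLinearMap_mul, mul_inv_cancel]
  rfl

omit [Module.Finite ℚ V₁] [Module.Finite ℚ V₂] in
/-- `↑g⁻¹ * ↑g = 1` (plumbing). [folklore] -/
private theorem coe_inv_mul_coe₄₆ (g : (V₁ × V₂) ≃ₗ[ℚ] (V₁ × V₂)) :
    ((g⁻¹ : (V₁ × V₂) ≃ₗ[ℚ] (V₁ × V₂)) : Module.End ℚ (V₁ × V₂)) * (g : Module.End ℚ (V₁ × V₂)) = 1 := by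
  rw [← LinearEquiv.coe_toLinearMap_mul, inv_mul_cancel]
  rfl

/-- **`Hom(H₁, H₂) = Hom(H₂, H₁) = 0` ⟹ `Aut(H₁) × Aut(H₂) →* Aut(H₁ ⊕ H₂)` is ONTO**: an automorphism of the Hodge structure `H₁ ⊕ H₂` is block diagonal with
blocks automorphisms of `H₁`, `H₂` («with equality holding if … `Hom(Aᵢ, Aⱼ) = 0`»). [cite: Milne1999LefschetzClasses, §1 p. 643] [cite: Moonen2004MT, §4 Lemma 4.6] -/
theorem autGroupProdCongrHom_surjective (hST : ∀ f : Hom H₁ H₂, f = 0) (hTS : ∀ g : Hom H₂ H₁, g = 0) :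
    Function.Surjective (autGroupProdCongrHom H₁ H₂) := by
  rintro ⟨g, hg⟩
  -- blocks of `↑g` and `↑g⁻¹`
  set a : Module.End ℚ (V₁ × V₂) := (g : Module.End ℚ (V₁ × V₂)) with ha
  set b : Module.End ℚ (V₁ × V₂) := ((g⁻¹ : (V₁ × V₂) ≃ₗ[ℚ] (V₁ × V₂)) : Module.End ℚ (V₁ × V₂)) with hb
  have haE : a ∈ (H₁.prod H₂).endAlg := hg
  have hbE : b ∈ (H₁.prod H₂).endAlg := (H₁.prod H₂).autGroup.inv_mem hg
  set a₁ := LinearMap.fst ℚ V₁ V₂ ∘ₗ a ∘ₗ LinearMap.inl ℚ V₁ V₂ with ha₁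
  set a₂ := LinearMap.snd ℚ V₁ V₂ ∘ₗ a ∘ₗ LinearMap.inr ℚ V₁ V₂ with ha₂
  set b₁ := LinearMap.fst ℚ V₁ V₂ ∘ₗ b ∘ₗ LinearMap.inl ℚ V₁ V₂ with hb₁
  set b₂ := LinearMap.snd ℚ V₁ V₂ ∘ₗ b ∘ₗ LinearMap.inr ℚ V₁ V₂ with hb₂
  have hab : a₁.prodMap a₂ * b₁.prodMap b₂ = 1 := by
    rw [← eq_prodMap_of_mem_endAlg_prod hST hTS haE, ← eq_prodMap_of_mem_endAlg_prod hST hTS hbE, ha, hb]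
    exact coe_mul_coe_inv₄₆ g
  have hba : b₁.prodMap b₂ * a₁.prodMap a₂ = 1 := by
    rw [← eq_prodMap_of_mem_endAlg_prod hST hTS haE, ← eq_prodMap_of_mem_endAlg_prod hST hTS hbE, ha, hb]
    exact coe_inv_mul_coe₄₆ g
  have hab₁ : a₁ * b₁ = 1 := LinearMap.ext fun v ↦ by
    have h := LinearMap.congr_fun hab (v, 0)
    simp only [Module.End.mul_apply, LinearMap.prodMap_apply, Module.End.one_apply, Prod.mk.injEq] at h
    rw [Module.End.mul_apply, Module.End.one_apply]
    exact h.1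
  have hab₂ : a₂ * b₂ = 1 := LinearMap.ext fun w ↦ by
    have h := LinearMap.congr_fun hab (0, w)
    simp only [Module.End.mul_apply, LinearMap.prodMap_apply, Module.End.one_apply, Prod.mk.injEq] at h
    rw [Module.End.mul_apply, Module.End.one_apply]
    exact h.2
  have hba₁ : b₁ * a₁ = 1 := LinearMap.ext fun v ↦ by
    have h := LinearMap.congr_fun hba (v, 0)
    simp only [Module.End.mul_apply, LinearMap.prodMap_apply, Module.End.one_apply, Prod.mk.injEq] at h
    rw [Module.End.mul_apply, Module.End.one_apply]
    exact h.1
  have hba₂ : b₂ * a₂ = 1 := LinearMap.ext fun w ↦ by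
    have h := LinearMap.congr_fun hba (0, w)
    simp only [Module.End.mul_apply, LinearMap.prodMap_apply, Module.End.one_apply, Prod.mk.injEq] at h
    rw [Module.End.mul_apply, Module.End.one_apply]
    exact h.2
  let g₁ : V₁ ≃ₗ[ℚ] V₁ := LinearEquiv.ofLinear a₁ b₁ hab₁ hba₁
  let g₂ : V₂ ≃ₗ[ℚ] V₂ := LinearEquiv.ofLinear a₂ b₂ hab₂ hba₂
  have hg₁ : g₁ ∈ H₁.autGroup := fst_comp_comp_inl_mem_endAlg H₁ H₂ haE
  have hg₂ : g₂ ∈ H₂.autGroup := snd_comp_comp_inr_mem_endAlg H₁ H₂ haE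
  refine ⟨(⟨g₁, hg₁⟩, ⟨g₂, hg₂⟩), Subtype.ext (LinearEquiv.toLinearMap_injective ?_)⟩
  rw [coe_autGroupProdCongrHom_apply, LinearEquiv.coe_prodCongr]
  change a₁.prodMap a₂ = a
  exact (eq_prodMap_of_mem_endAlg_prod hST hTS haE).symm

omit [Module.Finite ℚ V₁] [Module.Finite ℚ V₂] in
/-- `(inr ∘ f ∘ fst)² = 0` (plumbing). [folklore] -/
private theorem inr_fst_sq₄₆ (f : V₁ →ₗ[ℚ] V₂) :
    (LinearMap.inr ℚ V₁ V₂ ∘ₗ f ∘ₗ LinearMap.fst ℚ V₁ V₂) * (LinearMap.inr ℚ V₁ V₂ ∘ₗ f ∘ₗ LinearMap.fst ℚ V₁ V₂) = 0 := by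
  ext <;> simp

omit [Module.Finite ℚ V₁] [Module.Finite ℚ V₂] in
/-- `(inl ∘ g ∘ snd)² = 0` (plumbing). [folklore] -/
private theorem inl_snd_sq₄₆ (g : V₂ →ₗ[ℚ] V₁) :
    (LinearMap.inl ℚ V₁ V₂ ∘ₗ g ∘ₗ LinearMap.snd ℚ V₁ V₂) * (LinearMap.inl ℚ V₁ V₂ ∘ₗ g ∘ₗ LinearMap.snd ℚ V₁ V₂) = 0 := by
  ext <;> simp

omit [Module.Finite ℚ V₁] [Module.Finite ℚ V₂] in
/-- For a square-zero `N`, `(1 + N)(1 - N) = 1` (plumbing). [folklore] -/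
private theorem one_add_mul_one_sub₄₆ {N : Module.End ℚ (V₁ × V₂)} (hN : N * N = 0) : (1 + N) * (1 - N) = 1 := by
  rw [add_mul, mul_sub, mul_sub, one_mul, mul_one, one_mul, hN, sub_zero, sub_add_cancel]

omit [Module.Finite ℚ V₁] [Module.Finite ℚ V₂] in
/-- For a square-zero `N`, `(1 - N)(1 + N) = 1` (plumbing). [folklore] -/
private theorem one_sub_mul_one_add₄₆ {N : Module.End ℚ (V₁ × V₂)} (hN : N * N = 0) : (1 - N) * (1 + N) = 1 := by
  rw [sub_mul, mul_add, mul_add, one_mul, mul_one, one_mul, hN, add_zero, add_sub_cancel_right]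

/-- **The UNIPOTENT `u_f = 1 + inr ∘ f ∘ fst` attached to a morphism `f : H₁ → H₂` is an automorphism of `H₁ ⊕ H₂`** (inverse `1 - inr ∘ f ∘ fst`), with
`u_f (v, 0) = (v, f v)`. [cite: DeligneHodgeII1971, 2.1] [cite: Milne1999LefschetzClasses, §1 p. 643] -/
theorem one_add_inr_hom_fst_mem_autGroup (f : Hom H₁ H₂) :
    LinearEquiv.ofLinear (1 + LinearMap.inr ℚ V₁ V₂ ∘ₗ f.toLinearMap ∘ₗ LinearMap.fst ℚ V₁ V₂) (1 - LinearMap.inr ℚ V₁ V₂ ∘ₗ f.toLinearMap ∘ₗ LinearMap.fst ℚ V₁ V₂)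
        (one_add_mul_one_sub₄₆ (inr_fst_sq₄₆ f.toLinearMap)) (one_sub_mul_one_add₄₆ (inr_fst_sq₄₆ f.toLinearMap)) ∈ (H₁.prod H₂).autGroup := by
  rw [mem_autGroup_iff]
  exact (H₁.prod H₂).endAlg.add_mem (H₁.prod H₂).endAlg.one_mem (inr_comp_hom_comp_fst_mem_endAlg_prod H₁ H₂ f)

/-- The symmetric unipotent `1 + inl ∘ g ∘ snd` for a morphism `g : H₂ → H₁`. [cite: DeligneHodgeII1971, 2.1] [cite: Milne1999LefschetzClasses, §1 p. 643] -/
theorem one_add_inl_hom_snd_mem_autGroup (g : Hom H₂ H₁) :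
    LinearEquiv.ofLinear (1 + LinearMap.inl ℚ V₁ V₂ ∘ₗ g.toLinearMap ∘ₗ LinearMap.snd ℚ V₁ V₂) (1 - LinearMap.inl ℚ V₁ V₂ ∘ₗ g.toLinearMap ∘ₗ LinearMap.snd ℚ V₁ V₂)
        (one_add_mul_one_sub₄₆ (inl_snd_sq₄₆ g.toLinearMap)) (one_sub_mul_one_add₄₆ (inl_snd_sq₄₆ g.toLinearMap)) ∈ (H₁.prod H₂).autGroup := by
  rw [mem_autGroup_iff]
  exact (H₁.prod H₂).endAlg.add_mem (H₁.prod H₂).endAlg.one_mem (inl_comp_hom_comp_snd_mem_endAlg_prod H₁ H₂ g)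

/-- **ONTO ⟹ `Hom(H₁, H₂) = Hom(H₂, H₁) = 0`**: if every automorphism of `H₁ ⊕ H₂` is block diagonal then the unipotents `u_f` force `f = 0` («equality … only if
`Hom(Aᵢ, Aⱼ) = 0`»). [cite: Milne1999LefschetzClasses, §1 p. 643] -/
theorem hom_eq_zero_of_autGroupProdCongrHom_surjective (h : Function.Surjective (autGroupProdCongrHom H₁ H₂)) :
    (∀ f : Hom H₁ H₂, f = 0) ∧ ∀ g : Hom H₂ H₁, g = 0 := by
  constructor
  · intro f
    obtain ⟨⟨⟨g₁, hg₁⟩, ⟨g₂, hg₂⟩⟩, hu⟩ := h ⟨_, one_add_inr_hom_fst_mem_autGroup f⟩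
    have hu' := congrArg Subtype.val hu
    rw [coe_autGroupProdCongrHom_apply] at hu'
    refine Hom.ext (LinearMap.ext fun v ↦ ?_)
    have h1 := LinearEquiv.congr_fun hu' (v, 0)
    rw [LinearEquiv.prodCongr_apply, LinearEquiv.ofLinear_apply] at h1
    have h2 := (Prod.ext_iff.1 h1).2
    simp only [map_zero, LinearMap.add_apply, Module.End.one_apply, LinearMap.coe_comp, Function.comp_apply, LinearMap.fst_apply, LinearMap.inr_apply,
      Prod.snd_add, zero_add] at h2
    rw [Hom.zero_toLinearMap, LinearMap.zero_apply]
    exact h2.symm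
  · intro g
    obtain ⟨⟨⟨g₁, hg₁⟩, ⟨g₂, hg₂⟩⟩, hu⟩ := h ⟨_, one_add_inl_hom_snd_mem_autGroup g⟩
    have hu' := congrArg Subtype.val hu
    rw [coe_autGroupProdCongrHom_apply] at hu'
    refine Hom.ext (LinearMap.ext fun w ↦ ?_)
    have h1 := LinearEquiv.congr_fun hu' (0, w)
    rw [LinearEquiv.prodCongr_apply, LinearEquiv.ofLinear_apply] at h1
    have h2 := (Prod.ext_iff.1 h1).1
    simp only [map_zero, LinearMap.add_apply, Module.End.one_apply, LinearMap.coe_comp, Function.comp_apply, LinearMap.snd_apply, LinearMap.inl_apply,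
      Prod.fst_add, zero_add] at h2
    rw [Hom.zero_toLinearMap, LinearMap.zero_apply]
    exact h2.symm

/-- **MILNE'S «`C(A) ⊂ C(A₁) × ⋯ × C(A_s)`, with equality holding if and only if `Hom(Aᵢ, Aⱼ) = 0`», on the automorphism groups: `Aut(H₁) × Aut(H₂) →* Aut(H₁ ⊕ H₂)` is
ONTO iff `Hom(H₁, H₂) = 0` and `Hom(H₂, H₁) = 0`.** [cite: Milne1999LefschetzClasses, §1 p. 643] -/
theorem autGroupProdCongrHom_surjective_iff :
    Function.Surjective (autGroupProdCongrHom H₁ H₂) ↔ (∀ f : Hom H₁ H₂, f = 0) ∧ ∀ g : Hom H₂ H₁, g = 0 :=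
  ⟨hom_eq_zero_of_autGroupProdCongrHom_surjective, fun h ↦ autGroupProdCongrHom_surjective h.1 h.2⟩

variable (H₁ H₂) in
/-- **`Aut(H₁) × Aut(H₂) ≃* Aut(H₁ ⊕ H₂)` when `Hom(H₁, H₂) = Hom(H₂, H₁) = 0`.** [cite: Milne1999LefschetzClasses, §1 p. 643 and Prop. 1.1] -/
def autGroupProdCongrMulEquiv (hST : ∀ f : Hom H₁ H₂, f = 0) (hTS : ∀ g : Hom H₂ H₁, g = 0) : H₁.autGroup × H₂.autGroup ≃* (H₁.prod H₂).autGroup :=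
  MulEquiv.ofBijective (autGroupProdCongrHom H₁ H₂) ⟨autGroupProdCongrHom_injective, autGroupProdCongrHom_surjective hST hTS⟩

/-- `autGroupProdCongrMulEquiv (g₁, g₂) = g₁ ⊕ g₂`. [cite: Milne1999LefschetzClasses, §1 p. 643] -/
@[simp]
theorem coe_autGroupProdCongrMulEquiv_apply (hST : ∀ f : Hom H₁ H₂, f = 0) (hTS : ∀ g : Hom H₂ H₁, g = 0) (g : H₁.autGroup × H₂.autGroup) :
    ((autGroupProdCongrMulEquiv H₁ H₂ hST hTS g : (H₁.prod H₂).autGroup) : (V₁ × V₂) ≃ₗ[ℚ] (V₁ × V₂)) = g.1.1.prodCongr g.2.1 :=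
  rfl

end Aut

/-! ## §3 Polarized: `Aut(H₁, Q₁) × Aut(H₂, Q₂) ↪ Aut(H₁ ⊕ H₂, Q₁ ⊕ Q₂)`, onto when `Hom = 0` -/

section Polarized

variable [Module.Finite ℚ V₁] [Module.Finite ℚ V₂] (ψ₁ : Polarization H₁) (ψ₂ : Polarization H₂)

omit [Module.Finite ℚ V₁] [Module.Finite ℚ V₂] in
/-- **`g₁ ⊕ g₂` is an isometry of `Q₁ ⊕ Q₂` iff `g₁`, `g₂` are isometries of `Q₁`, `Q₂`** (`(Q₁ ⊕ Q₂)((v, w), (v′, w′)) = Q₁(v, v′) + Q₂(w, w′)`).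
[cite: DeligneHodgeII1971, 2.1.15] [cite: Milne1999LefschetzClasses, §1 p. 643] -/
theorem prodCongr_mem_isometryGroup_prod_iff (g₁ : V₁ ≃ₗ[ℚ] V₁) (g₂ : V₂ ≃ₗ[ℚ] V₂) :
    g₁.prodCongr g₂ ∈ (ψ₁.prod ψ₂).isometryGroup ↔ g₁ ∈ ψ₁.isometryGroup ∧ g₂ ∈ ψ₂.isometryGroup := by
  simp only [Polarization.mem_isometryGroup_iff, Polarization.prod_form_apply, LinearEquiv.prodCongr_apply]
  refine ⟨fun h ↦ ⟨fun v v' ↦ ?_, fun w w' ↦ ?_⟩, fun h x y ↦ by rw [h.1, h.2]⟩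
  · simpa using h (v, 0) (v', 0)
  · simpa using h (0, w) (0, w')

/-- **`g₁ ⊕ g₂ ∈ Aut(H₁ ⊕ H₂, Q₁ ⊕ Q₂) ⟺ gᵢ ∈ Aut(Hᵢ, Qᵢ)`.** [cite: Milne1999LefschetzClasses, §1 p. 643] -/
theorem prodCongr_mem_polarizationAutGroup_prod_iff (g₁ : V₁ ≃ₗ[ℚ] V₁) (g₂ : V₂ ≃ₗ[ℚ] V₂) :
    g₁.prodCongr g₂ ∈ (ψ₁.prod ψ₂).autGroup ↔ g₁ ∈ ψ₁.autGroup ∧ g₂ ∈ ψ₂.autGroup := by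
  show g₁.prodCongr g₂ ∈ (H₁.prod H₂).autGroup ⊓ (ψ₁.prod ψ₂).isometryGroup ↔ g₁ ∈ H₁.autGroup ⊓ ψ₁.isometryGroup ∧ g₂ ∈ H₂.autGroup ⊓ ψ₂.isometryGroup
  rw [Subgroup.mem_inf, Subgroup.mem_inf, Subgroup.mem_inf, prodCongr_mem_autGroup_prod_iff, prodCongr_mem_isometryGroup_prod_iff]
  tauto

/-- **The block-diagonal homomorphism `Aut(H₁, Q₁) × Aut(H₂, Q₂) →* Aut(H₁ ⊕ H₂, Q₁ ⊕ Q₂)`.** [cite: Milne1999LefschetzClasses, §1 p. 643] -/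
def Polarization.autGroupProdCongrHom : ψ₁.autGroup × ψ₂.autGroup →* (ψ₁.prod ψ₂).autGroup where
  toFun g := ⟨g.1.1.prodCongr g.2.1, (prodCongr_mem_polarizationAutGroup_prod_iff ψ₁ ψ₂ g.1.1 g.2.1).2 ⟨g.1.2, g.2.2⟩⟩
  map_one' := Subtype.ext (LinearEquiv.ext fun _ ↦ rfl)
  map_mul' _ _ := Subtype.ext (LinearEquiv.ext fun _ ↦ rfl)

/-- `Polarization.autGroupProdCongrHom (g₁, g₂) = g₁ ⊕ g₂`. [cite: Milne1999LefschetzClasses, §1 p. 643] -/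
@[simp]
theorem Polarization.coe_autGroupProdCongrHom_apply (g : ψ₁.autGroup × ψ₂.autGroup) :
    ((ψ₁.autGroupProdCongrHom ψ₂ g : (ψ₁.prod ψ₂).autGroup) : (V₁ × V₂) ≃ₗ[ℚ] (V₁ × V₂)) = g.1.1.prodCongr g.2.1 :=
  rfl

/-- `Aut(H₁, Q₁) × Aut(H₂, Q₂) →* Aut(H₁ ⊕ H₂, Q₁ ⊕ Q₂)` is injective. [cite: Milne1999LefschetzClasses, §1 p. 643] -/
theorem Polarization.autGroupProdCongrHom_injective : Function.Injective (ψ₁.autGroupProdCongrHom ψ₂) := by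
  intro x y h
  have h' : x.1.1.prodCongr x.2.1 = y.1.1.prodCongr y.2.1 := congrArg Subtype.val h
  refine Prod.ext (Subtype.ext (LinearEquiv.ext fun v ↦ ?_)) (Subtype.ext (LinearEquiv.ext fun w ↦ ?_))
  · have h1 := LinearEquiv.congr_fun h' (v, 0)
    rw [LinearEquiv.prodCongr_apply, LinearEquiv.prodCongr_apply] at h1
    exact (Prod.ext_iff.1 h1).1
  · have h1 := LinearEquiv.congr_fun h' (0, w)
    rw [LinearEquiv.prodCongr_apply, LinearEquiv.prodCongr_apply] at h1
    exact (Prod.ext_iff.1 h1).2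

/-- **`Hom = 0` ⟹ `Aut(H₁, Q₁) × Aut(H₂, Q₂) →* Aut(H₁ ⊕ H₂, Q₁ ⊕ Q₂)` is onto**: a Hodge isometry of `H₁ ⊕ H₂` is block diagonal and its blocks are Hodge isometries.
[cite: Milne1999LefschetzClasses, §1 p. 643 and Prop. 1.1] -/
theorem Polarization.autGroupProdCongrHom_surjective (hST : ∀ f : Hom H₁ H₂, f = 0) (hTS : ∀ g : Hom H₂ H₁, g = 0) :
    Function.Surjective (ψ₁.autGroupProdCongrHom ψ₂) := by
  rintro ⟨g, hg⟩
  obtain ⟨⟨⟨g₁, hg₁⟩, ⟨g₂, hg₂⟩⟩, h⟩ := HodgeStructure.autGroupProdCongrHom_surjective hST hTS ⟨g, hg.1⟩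
  have h' : g₁.prodCongr g₂ = g := congrArg Subtype.val h
  have hiso : g₁.prodCongr g₂ ∈ (ψ₁.prod ψ₂).isometryGroup := by
    rw [h']
    exact hg.2
  have hiso' := (HodgeStructure.prodCongr_mem_isometryGroup_prod_iff ψ₁ ψ₂ g₁ g₂).1 hiso
  exact ⟨(⟨g₁, ⟨hg₁, hiso'.1⟩⟩, ⟨g₂, ⟨hg₂, hiso'.2⟩⟩), Subtype.ext h'⟩

/-- **`Aut(H₁, Q₁) × Aut(H₂, Q₂) ≃* Aut(H₁ ⊕ H₂, Q₁ ⊕ Q₂)` when `Hom(H₁, H₂) = Hom(H₂, H₁) = 0`.** [cite: Milne1999LefschetzClasses, §1 p. 643 and Prop. 1.1] -/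
def Polarization.autGroupProdCongrMulEquiv (hST : ∀ f : Hom H₁ H₂, f = 0) (hTS : ∀ g : Hom H₂ H₁, g = 0) :
    ψ₁.autGroup × ψ₂.autGroup ≃* (ψ₁.prod ψ₂).autGroup :=
  MulEquiv.ofBijective (ψ₁.autGroupProdCongrHom ψ₂) ⟨ψ₁.autGroupProdCongrHom_injective ψ₂, ψ₁.autGroupProdCongrHom_surjective ψ₂ hST hTS⟩

/-- `Polarization.autGroupProdCongrMulEquiv (g₁, g₂) = g₁ ⊕ g₂`. [cite: Milne1999LefschetzClasses, §1 p. 643] -/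
@[simp]
theorem Polarization.coe_autGroupProdCongrMulEquiv_apply (hST : ∀ f : Hom H₁ H₂, f = 0) (hTS : ∀ g : Hom H₂ H₁, g = 0) (g : ψ₁.autGroup × ψ₂.autGroup) :
    ((ψ₁.autGroupProdCongrMulEquiv ψ₂ hST hTS g : (ψ₁.prod ψ₂).autGroup) : (V₁ × V₂) ≃ₗ[ℚ] (V₁ × V₂)) = g.1.1.prodCongr g.2.1 :=
  rfl

end Polarized

end HodgeStructure

end Literature.AlgebraicGeometry.Motives
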